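import Summits.Ventures.CertifiedManyBodySolver.Upper.DWaveSourceOpenClusterCap
import HarnessLib

/-!
# Ventures/CertifiedManyBodySolver — Upper/SourcedBoxNodeMuShift.lean

HONEST FRAMING: first certified bounds; not a superconductivity verdict; every number certified or labelled float.
Nothing in this file is a number: it is a soundness edge of the W5 / FORMAT-mpsgf1 sourced-box certificates
(IRD desk seat 5, `sr-mbsolver-ird-5`; companions `Upper/SourcedBoxNodeOf*.lean`, `Upper/ProducersFrameSourcedBoxNode.lean`).

**μ-TRANSPORT OF A SOURCED-BOX CLAIM NODE.** The open `a × b` sourced cluster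
`A_C(μ) = dWaveSourceOpenBox a b U μ h = hamiltonianWith (rectBoxGraph a b) 1 U μ − h (P_C + P_Cᴴ)` is affine in the
chemical potential: `A_C(μ) = A_C(μ₀) + (μ₀ − μ) • N` (`dWaveSourceOpenBox_eq_add_smul_totalNumber`). Hence ONE
certificate at `μ₀` — the five-conjunct claim node `∃ ψ, HasParity p ψ ∧ ‖ψ‖ = 1 ∧ Re⟨ψ, A_C(μ₀) ψ⟩ ≤ e·ab ∧
n_lo·ab ≤ Re⟨ψ, Nψ⟩ ≤ n_hi·ab` of a FORMAT-mpsgf1 certificate (its CERTIFIED density window `[n_lo, n_hi]`) — gives the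
same node at EVERY `μ` with the energy slot `e′ ≥ e + (μ₀ − μ)·n_hi` when `μ ≤ μ₀` and `e′ ≥ e + (μ₀ − μ)·n_lo` when
`μ₀ ≤ μ` (same witness; `sourcedBoxNode_muShift_of_le`, `sourcedBoxNode_muShift_of_ge`), and therefore, by pin-1's
transport `sourcedEnergyUpperRow_of_exists_clusterState`, the uniform sourced energy CEILING row
`SourcedEnergyUpperRow 0 U μ h q L₀ e′` at every `μ` from a parity-`0` node at `μ₀`
(`sourcedEnergyUpperRow_muShift_of_le`, `sourcedEnergyUpperRow_muShift_of_ge`). The loss against a fresh run at `μ` is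
second order in `μ − μ₀` (compressibility); e.g. the `μ₀ = 7/4` 32×4 twins give rigorous grand-canonical ceilings at
`μ* = 980464777135/2³⁹` without a new DMRG state. This is the elementary variational fact
`E₀(H − μN) ≤ ⟨ψ, (H − μ₀N)ψ⟩ + (μ₀ − μ)⟨ψ, Nψ⟩`; Lieb (1989) uses the same `μN` bookkeeping.

References: E. H. Lieb, Phys. Rev. Lett. 62 (1989) 1201 (grand-canonical Hubbard Hamiltonian `H − μN`);
T. Koma, H. Tasaki, J. Stat. Phys. 76 (1994) 745, §1 (the sourced Hamiltonian). Tree: `hamiltonianWith_eq`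
(`Literature/…/HubbardModel.lean`), `dWaveSourceOpenBox`, `sourcedEnergyUpperRow_of_exists_clusterState`.
-/

noncomputable section

namespace Summit.Ventures.CertifiedManyBodySolver

open Matrix Literature.Probability.LatticeModels Literature.MathematicalPhysics.QuantumLattice
open Literature.MathematicalPhysics.QuantumLattice.TwoCluster HubbardWave0

variable (a b : ℕ)

/-- **`A_C(μ) = A_C(μ₀) + (μ₀ − μ) • N`**: the open sourced cluster is affine in the chemical potential (the source and the
Hubbard part do not involve `μ`; `hamiltonianWith G t U μ = hamiltonian G t U − μ • N`). [cite: Lieb1989, eq. (1)] -/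
theorem dWaveSourceOpenBox_eq_add_smul_totalNumber (U μ₀ μ h : ℝ) :
    dWaveSourceOpenBox a b U μ h = dWaveSourceOpenBox a b U μ₀ h + (((μ₀ - μ : ℝ) : ℂ)) • totalNumber := by
  unfold dWaveSourceOpenBox
  rw [hamiltonianWith_eq, hamiltonianWith_eq, Complex.ofReal_sub, sub_smul]
  abel

/-- **`Re⟨ψ, A_C(μ)ψ⟩ = Re⟨ψ, A_C(μ₀)ψ⟩ + (μ₀ − μ)·Re⟨ψ, Nψ⟩`** for every vector `ψ`. [cite: Lieb1989, eq. (1)] -/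
theorem re_star_dotProduct_dWaveSourceOpenBox_mulVec_eq (U μ₀ μ h : ℝ) (ψ : Fock (Orb (Fin a ×ₗ Fin b))) :
    (star ψ ⬝ᵥ (dWaveSourceOpenBox a b U μ h *ᵥ ψ)).re =
      (star ψ ⬝ᵥ (dWaveSourceOpenBox a b U μ₀ h *ᵥ ψ)).re + (μ₀ - μ) * (star ψ ⬝ᵥ (totalNumber *ᵥ ψ)).re := by
  rw [dWaveSourceOpenBox_eq_add_smul_totalNumber a b U μ₀ μ h, add_mulVec, smul_mulVec, dotProduct_add,
    dotProduct_smul, Complex.add_re, smul_eq_mul, Complex.re_ofReal_mul]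

/-- **μ-transport of the claim node, downward in `μ`** (`μ ≤ μ₀`, the density CEILING `n_hi` enters): a five-conjunct
sourced-box node at `μ₀` with slots `(e, n_lo, n_hi)` gives the node at `μ` with any energy slot
`e′ ≥ e + (μ₀ − μ)·n_hi` — same witness, same parity, same density window. [cite: Lieb1989, eq. (1)] -/
theorem sourcedBoxNode_muShift_of_le (U μ₀ μ h : ℝ) (hμ : μ ≤ μ₀) (e nlo nhi e' : ℚ)
    (he' : (e : ℝ) + (μ₀ - μ) * nhi ≤ e') {p : ℕ}
    (hnode : ∃ ψ : Fock (Orb (Fin a ×ₗ Fin b)), HasParity p ψ ∧ star ψ ⬝ᵥ ψ = 1 ∧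
      (star ψ ⬝ᵥ (dWaveSourceOpenBox a b U μ₀ h *ᵥ ψ)).re ≤ ((e : ℚ) : ℝ) * ((a : ℝ) * b) ∧
      ((nlo : ℚ) : ℝ) * ((a : ℝ) * b) ≤ (star ψ ⬝ᵥ (totalNumber *ᵥ ψ)).re ∧
      (star ψ ⬝ᵥ (totalNumber *ᵥ ψ)).re ≤ ((nhi : ℚ) : ℝ) * ((a : ℝ) * b)) :
    ∃ ψ : Fock (Orb (Fin a ×ₗ Fin b)), HasParity p ψ ∧ star ψ ⬝ᵥ ψ = 1 ∧
      (star ψ ⬝ᵥ (dWaveSourceOpenBox a b U μ h *ᵥ ψ)).re ≤ ((e' : ℚ) : ℝ) * ((a : ℝ) * b) ∧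
      ((nlo : ℚ) : ℝ) * ((a : ℝ) * b) ≤ (star ψ ⬝ᵥ (totalNumber *ᵥ ψ)).re ∧
      (star ψ ⬝ᵥ (totalNumber *ᵥ ψ)).re ≤ ((nhi : ℚ) : ℝ) * ((a : ℝ) * b) := by
  obtain ⟨ψ, hpar, h1, hE, hlo, hhi⟩ := hnode
  refine ⟨ψ, hpar, h1, ?_, hlo, hhi⟩
  have hab : (0 : ℝ) ≤ (a : ℝ) * b := by positivity
  have hd : 0 ≤ μ₀ - μ := sub_nonneg.2 hμ
  rw [re_star_dotProduct_dWaveSourceOpenBox_mulVec_eq a b U μ₀ μ h ψ]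
  calc (star ψ ⬝ᵥ (dWaveSourceOpenBox a b U μ₀ h *ᵥ ψ)).re + (μ₀ - μ) * (star ψ ⬝ᵥ (totalNumber *ᵥ ψ)).re
      ≤ (e : ℝ) * ((a : ℝ) * b) + (μ₀ - μ) * ((nhi : ℝ) * ((a : ℝ) * b)) :=
        add_le_add hE (mul_le_mul_of_nonneg_left hhi hd)
    _ = ((e : ℝ) + (μ₀ - μ) * nhi) * ((a : ℝ) * b) := by ring
    _ ≤ (e' : ℝ) * ((a : ℝ) * b) := mul_le_mul_of_nonneg_right he' hab

/-- **μ-transport of the claim node, upward in `μ`** (`μ₀ ≤ μ`, the density FLOOR `n_lo` enters): a five-conjunct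
sourced-box node at `μ₀` with slots `(e, n_lo, n_hi)` gives the node at `μ` with any energy slot
`e′ ≥ e + (μ₀ − μ)·n_lo`. [cite: Lieb1989, eq. (1)] -/
theorem sourcedBoxNode_muShift_of_ge (U μ₀ μ h : ℝ) (hμ : μ₀ ≤ μ) (e nlo nhi e' : ℚ)
    (he' : (e : ℝ) + (μ₀ - μ) * nlo ≤ e') {p : ℕ}
    (hnode : ∃ ψ : Fock (Orb (Fin a ×ₗ Fin b)), HasParity p ψ ∧ star ψ ⬝ᵥ ψ = 1 ∧
      (star ψ ⬝ᵥ (dWaveSourceOpenBox a b U μ₀ h *ᵥ ψ)).re ≤ ((e : ℚ) : ℝ) * ((a : ℝ) * b) ∧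
      ((nlo : ℚ) : ℝ) * ((a : ℝ) * b) ≤ (star ψ ⬝ᵥ (totalNumber *ᵥ ψ)).re ∧
      (star ψ ⬝ᵥ (totalNumber *ᵥ ψ)).re ≤ ((nhi : ℚ) : ℝ) * ((a : ℝ) * b)) :
    ∃ ψ : Fock (Orb (Fin a ×ₗ Fin b)), HasParity p ψ ∧ star ψ ⬝ᵥ ψ = 1 ∧
      (star ψ ⬝ᵥ (dWaveSourceOpenBox a b U μ h *ᵥ ψ)).re ≤ ((e' : ℚ) : ℝ) * ((a : ℝ) * b) ∧
      ((nlo : ℚ) : ℝ) * ((a : ℝ) * b) ≤ (star ψ ⬝ᵥ (totalNumber *ᵥ ψ)).re ∧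
      (star ψ ⬝ᵥ (totalNumber *ᵥ ψ)).re ≤ ((nhi : ℚ) : ℝ) * ((a : ℝ) * b) := by
  obtain ⟨ψ, hpar, h1, hE, hlo, hhi⟩ := hnode
  refine ⟨ψ, hpar, h1, ?_, hlo, hhi⟩
  have hab : (0 : ℝ) ≤ (a : ℝ) * b := by positivity
  have hd : μ₀ - μ ≤ 0 := sub_nonpos.2 hμ
  rw [re_star_dotProduct_dWaveSourceOpenBox_mulVec_eq a b U μ₀ μ h ψ]
  calc (star ψ ⬝ᵥ (dWaveSourceOpenBox a b U μ₀ h *ᵥ ψ)).re + (μ₀ - μ) * (star ψ ⬝ᵥ (totalNumber *ᵥ ψ)).re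
      ≤ (e : ℝ) * ((a : ℝ) * b) + (μ₀ - μ) * ((nlo : ℝ) * ((a : ℝ) * b)) :=
        add_le_add hE (mul_le_mul_of_nonpos_left hlo hd)
    _ = ((e : ℝ) + (μ₀ - μ) * nlo) * ((a : ℝ) * b) := by ring
    _ ≤ (e' : ℝ) * ((a : ℝ) * b) := mul_le_mul_of_nonneg_right he' hab

/-- **The uniform sourced energy CEILING row at `μ ≤ μ₀` from a parity-`0` node at `μ₀`**: for every side progression
`q` with `a ∣ q`, `b ∣ q` and onset `L₀ > a, b`, `SourcedEnergyUpperRow 0 U μ h q L₀ e′` with `e′ ≥ e + (μ₀ − μ)·n_hi`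
(pin-1's transport `sourcedEnergyUpperRow_of_exists_clusterState` applied to the shifted node). [cite: Lieb1989, eq. (1)] -/
theorem sourcedEnergyUpperRow_muShift_of_le {q L₀ : ℕ} (hqa : a ∣ q) (hqb : b ∣ q) (hLa0 : a < L₀) (hLb0 : b < L₀)
    (U μ₀ μ h : ℝ) (hμ : μ ≤ μ₀) (e nlo nhi e' : ℚ) (he' : (e : ℝ) + (μ₀ - μ) * nhi ≤ e')
    (hnode : ∃ ψ : Fock (Orb (Fin a ×ₗ Fin b)), HasParity 0 ψ ∧ star ψ ⬝ᵥ ψ = 1 ∧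
      (star ψ ⬝ᵥ (dWaveSourceOpenBox a b U μ₀ h *ᵥ ψ)).re ≤ ((e : ℚ) : ℝ) * ((a : ℝ) * b) ∧
      ((nlo : ℚ) : ℝ) * ((a : ℝ) * b) ≤ (star ψ ⬝ᵥ (totalNumber *ᵥ ψ)).re ∧
      (star ψ ⬝ᵥ (totalNumber *ᵥ ψ)).re ≤ ((nhi : ℚ) : ℝ) * ((a : ℝ) * b)) :
    SourcedEnergyUpperRow 0 U μ h q L₀ e' := by
  obtain ⟨ψ, hpar, h1, hE, -, -⟩ := sourcedBoxNode_muShift_of_le a b U μ₀ μ h hμ e nlo nhi e' he' hnode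
  exact sourcedEnergyUpperRow_of_exists_clusterState hqa hqb hLa0 hLb0 U μ h ⟨ψ, hpar, h1, hE⟩

/-- **The uniform sourced energy CEILING row at `μ ≥ μ₀` from a parity-`0` node at `μ₀`**:
`SourcedEnergyUpperRow 0 U μ h q L₀ e′` with `e′ ≥ e + (μ₀ − μ)·n_lo`. [cite: Lieb1989, eq. (1)] -/
theorem sourcedEnergyUpperRow_muShift_of_ge {q L₀ : ℕ} (hqa : a ∣ q) (hqb : b ∣ q) (hLa0 : a < L₀) (hLb0 : b < L₀)
    (U μ₀ μ h : ℝ) (hμ : μ₀ ≤ μ) (e nlo nhi e' : ℚ) (he' : (e : ℝ) + (μ₀ - μ) * nlo ≤ e')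
    (hnode : ∃ ψ : Fock (Orb (Fin a ×ₗ Fin b)), HasParity 0 ψ ∧ star ψ ⬝ᵥ ψ = 1 ∧
      (star ψ ⬝ᵥ (dWaveSourceOpenBox a b U μ₀ h *ᵥ ψ)).re ≤ ((e : ℚ) : ℝ) * ((a : ℝ) * b) ∧
      ((nlo : ℚ) : ℝ) * ((a : ℝ) * b) ≤ (star ψ ⬝ᵥ (totalNumber *ᵥ ψ)).re ∧
      (star ψ ⬝ᵥ (totalNumber *ᵥ ψ)).re ≤ ((nhi : ℚ) : ℝ) * ((a : ℝ) * b)) :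
    SourcedEnergyUpperRow 0 U μ h q L₀ e' := by
  obtain ⟨ψ, hpar, h1, hE, -, -⟩ := sourcedBoxNode_muShift_of_ge a b U μ₀ μ h hμ e nlo nhi e' he' hnode
  exact sourcedEnergyUpperRow_of_exists_clusterState hqa hqb hLa0 hLb0 U μ h ⟨ψ, hpar, h1, hE⟩

/-- **μ-transport of the TWO-FIELD (seven-conjunct) claim node, downward in `μ`** (`μ ≤ μ₀`, `d := μ₀ − μ ≥ 0`): the
zero-field window moves with the density window, `Re⟨ψ, A_C(μ,0)ψ⟩ ∈ [e0lo + d·n_lo, e0hi + d·n_hi]·ab`, and the energy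
slot as in `sourcedBoxNode_muShift_of_le` (hubbard-cq-obsth-2's node shape). [cite: Lieb1989, eq. (1)] -/
theorem sourcedBoxTwoFieldNode_muShift_of_le (U μ₀ μ h : ℝ) (hμ : μ ≤ μ₀) (e nlo nhi e0lo e0hi e' e0lo' e0hi' : ℚ)
    (he' : (e : ℝ) + (μ₀ - μ) * nhi ≤ e') (he0lo' : (e0lo' : ℝ) ≤ e0lo + (μ₀ - μ) * nlo)
    (he0hi' : (e0hi : ℝ) + (μ₀ - μ) * nhi ≤ e0hi') {p : ℕ}
    (hnode : ∃ ψ : Fock (Orb (Fin a ×ₗ Fin b)), HasParity p ψ ∧ star ψ ⬝ᵥ ψ = 1 ∧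
      (star ψ ⬝ᵥ (dWaveSourceOpenBox a b U μ₀ h *ᵥ ψ)).re ≤ ((e : ℚ) : ℝ) * ((a : ℝ) * b) ∧
      ((nlo : ℚ) : ℝ) * ((a : ℝ) * b) ≤ (star ψ ⬝ᵥ (totalNumber *ᵥ ψ)).re ∧
      (star ψ ⬝ᵥ (totalNumber *ᵥ ψ)).re ≤ ((nhi : ℚ) : ℝ) * ((a : ℝ) * b) ∧
      ((e0lo : ℚ) : ℝ) * ((a : ℝ) * b) ≤ (star ψ ⬝ᵥ (dWaveSourceOpenBox a b U μ₀ 0 *ᵥ ψ)).re ∧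
      (star ψ ⬝ᵥ (dWaveSourceOpenBox a b U μ₀ 0 *ᵥ ψ)).re ≤ ((e0hi : ℚ) : ℝ) * ((a : ℝ) * b)) :
    ∃ ψ : Fock (Orb (Fin a ×ₗ Fin b)), HasParity p ψ ∧ star ψ ⬝ᵥ ψ = 1 ∧
      (star ψ ⬝ᵥ (dWaveSourceOpenBox a b U μ h *ᵥ ψ)).re ≤ ((e' : ℚ) : ℝ) * ((a : ℝ) * b) ∧
      ((nlo : ℚ) : ℝ) * ((a : ℝ) * b) ≤ (star ψ ⬝ᵥ (totalNumber *ᵥ ψ)).re ∧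
      (star ψ ⬝ᵥ (totalNumber *ᵥ ψ)).re ≤ ((nhi : ℚ) : ℝ) * ((a : ℝ) * b) ∧
      ((e0lo' : ℚ) : ℝ) * ((a : ℝ) * b) ≤ (star ψ ⬝ᵥ (dWaveSourceOpenBox a b U μ 0 *ᵥ ψ)).re ∧
      (star ψ ⬝ᵥ (dWaveSourceOpenBox a b U μ 0 *ᵥ ψ)).re ≤ ((e0hi' : ℚ) : ℝ) * ((a : ℝ) * b) := by
  obtain ⟨ψ, hpar, h1, hE, hlo, hhi, h0lo, h0hi⟩ := hnode
  have hab : (0 : ℝ) ≤ (a : ℝ) * b := by positivity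
  have hd : 0 ≤ μ₀ - μ := sub_nonneg.2 hμ
  refine ⟨ψ, hpar, h1, ?_, hlo, hhi, ?_, ?_⟩
  · rw [re_star_dotProduct_dWaveSourceOpenBox_mulVec_eq a b U μ₀ μ h ψ]
    calc (star ψ ⬝ᵥ (dWaveSourceOpenBox a b U μ₀ h *ᵥ ψ)).re + (μ₀ - μ) * (star ψ ⬝ᵥ (totalNumber *ᵥ ψ)).re
        ≤ (e : ℝ) * ((a : ℝ) * b) + (μ₀ - μ) * ((nhi : ℝ) * ((a : ℝ) * b)) :=
          add_le_add hE (mul_le_mul_of_nonneg_left hhi hd)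
      _ = ((e : ℝ) + (μ₀ - μ) * nhi) * ((a : ℝ) * b) := by ring
      _ ≤ (e' : ℝ) * ((a : ℝ) * b) := mul_le_mul_of_nonneg_right he' hab
  · rw [re_star_dotProduct_dWaveSourceOpenBox_mulVec_eq a b U μ₀ μ 0 ψ]
    calc ((e0lo' : ℚ) : ℝ) * ((a : ℝ) * b) ≤ ((e0lo : ℝ) + (μ₀ - μ) * nlo) * ((a : ℝ) * b) :=
          mul_le_mul_of_nonneg_right he0lo' hab
      _ = (e0lo : ℝ) * ((a : ℝ) * b) + (μ₀ - μ) * ((nlo : ℝ) * ((a : ℝ) * b)) := by ring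
      _ ≤ (star ψ ⬝ᵥ (dWaveSourceOpenBox a b U μ₀ 0 *ᵥ ψ)).re + (μ₀ - μ) * (star ψ ⬝ᵥ (totalNumber *ᵥ ψ)).re :=
          add_le_add h0lo (mul_le_mul_of_nonneg_left hlo hd)
  · rw [re_star_dotProduct_dWaveSourceOpenBox_mulVec_eq a b U μ₀ μ 0 ψ]
    calc (star ψ ⬝ᵥ (dWaveSourceOpenBox a b U μ₀ 0 *ᵥ ψ)).re + (μ₀ - μ) * (star ψ ⬝ᵥ (totalNumber *ᵥ ψ)).re
        ≤ (e0hi : ℝ) * ((a : ℝ) * b) + (μ₀ - μ) * ((nhi : ℝ) * ((a : ℝ) * b)) :=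
          add_le_add h0hi (mul_le_mul_of_nonneg_left hhi hd)
      _ = ((e0hi : ℝ) + (μ₀ - μ) * nhi) * ((a : ℝ) * b) := by ring
      _ ≤ (e0hi' : ℝ) * ((a : ℝ) * b) := mul_le_mul_of_nonneg_right he0hi' hab

/-- **μ-transport of the TWO-FIELD claim node, upward in `μ`** (`μ₀ ≤ μ`, `d := μ₀ − μ ≤ 0`):
`Re⟨ψ, A_C(μ,0)ψ⟩ ∈ [e0lo + d·n_hi, e0hi + d·n_lo]·ab`, energy slot `e′ ≥ e + d·n_lo`. [cite: Lieb1989, eq. (1)] -/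
theorem sourcedBoxTwoFieldNode_muShift_of_ge (U μ₀ μ h : ℝ) (hμ : μ₀ ≤ μ) (e nlo nhi e0lo e0hi e' e0lo' e0hi' : ℚ)
    (he' : (e : ℝ) + (μ₀ - μ) * nlo ≤ e') (he0lo' : (e0lo' : ℝ) ≤ e0lo + (μ₀ - μ) * nhi)
    (he0hi' : (e0hi : ℝ) + (μ₀ - μ) * nlo ≤ e0hi') {p : ℕ}
    (hnode : ∃ ψ : Fock (Orb (Fin a ×ₗ Fin b)), HasParity p ψ ∧ star ψ ⬝ᵥ ψ = 1 ∧
      (star ψ ⬝ᵥ (dWaveSourceOpenBox a b U μ₀ h *ᵥ ψ)).re ≤ ((e : ℚ) : ℝ) * ((a : ℝ) * b) ∧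
      ((nlo : ℚ) : ℝ) * ((a : ℝ) * b) ≤ (star ψ ⬝ᵥ (totalNumber *ᵥ ψ)).re ∧
      (star ψ ⬝ᵥ (totalNumber *ᵥ ψ)).re ≤ ((nhi : ℚ) : ℝ) * ((a : ℝ) * b) ∧
      ((e0lo : ℚ) : ℝ) * ((a : ℝ) * b) ≤ (star ψ ⬝ᵥ (dWaveSourceOpenBox a b U μ₀ 0 *ᵥ ψ)).re ∧
      (star ψ ⬝ᵥ (dWaveSourceOpenBox a b U μ₀ 0 *ᵥ ψ)).re ≤ ((e0hi : ℚ) : ℝ) * ((a : ℝ) * b)) :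
    ∃ ψ : Fock (Orb (Fin a ×ₗ Fin b)), HasParity p ψ ∧ star ψ ⬝ᵥ ψ = 1 ∧
      (star ψ ⬝ᵥ (dWaveSourceOpenBox a b U μ h *ᵥ ψ)).re ≤ ((e' : ℚ) : ℝ) * ((a : ℝ) * b) ∧
      ((nlo : ℚ) : ℝ) * ((a : ℝ) * b) ≤ (star ψ ⬝ᵥ (totalNumber *ᵥ ψ)).re ∧
      (star ψ ⬝ᵥ (totalNumber *ᵥ ψ)).re ≤ ((nhi : ℚ) : ℝ) * ((a : ℝ) * b) ∧
      ((e0lo' : ℚ) : ℝ) * ((a : ℝ) * b) ≤ (star ψ ⬝ᵥ (dWaveSourceOpenBox a b U μ 0 *ᵥ ψ)).re ∧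
      (star ψ ⬝ᵥ (dWaveSourceOpenBox a b U μ 0 *ᵥ ψ)).re ≤ ((e0hi' : ℚ) : ℝ) * ((a : ℝ) * b) := by
  obtain ⟨ψ, hpar, h1, hE, hlo, hhi, h0lo, h0hi⟩ := hnode
  have hab : (0 : ℝ) ≤ (a : ℝ) * b := by positivity
  have hd : μ₀ - μ ≤ 0 := sub_nonpos.2 hμ
  refine ⟨ψ, hpar, h1, ?_, hlo, hhi, ?_, ?_⟩
  · rw [re_star_dotProduct_dWaveSourceOpenBox_mulVec_eq a b U μ₀ μ h ψ]
    calc (star ψ ⬝ᵥ (dWaveSourceOpenBox a b U μ₀ h *ᵥ ψ)).re + (μ₀ - μ) * (star ψ ⬝ᵥ (totalNumber *ᵥ ψ)).re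
        ≤ (e : ℝ) * ((a : ℝ) * b) + (μ₀ - μ) * ((nlo : ℝ) * ((a : ℝ) * b)) :=
          add_le_add hE (mul_le_mul_of_nonpos_left hlo hd)
      _ = ((e : ℝ) + (μ₀ - μ) * nlo) * ((a : ℝ) * b) := by ring
      _ ≤ (e' : ℝ) * ((a : ℝ) * b) := mul_le_mul_of_nonneg_right he' hab
  · rw [re_star_dotProduct_dWaveSourceOpenBox_mulVec_eq a b U μ₀ μ 0 ψ]
    calc ((e0lo' : ℚ) : ℝ) * ((a : ℝ) * b) ≤ ((e0lo : ℝ) + (μ₀ - μ) * nhi) * ((a : ℝ) * b) :=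
          mul_le_mul_of_nonneg_right he0lo' hab
      _ = (e0lo : ℝ) * ((a : ℝ) * b) + (μ₀ - μ) * ((nhi : ℝ) * ((a : ℝ) * b)) := by ring
      _ ≤ (star ψ ⬝ᵥ (dWaveSourceOpenBox a b U μ₀ 0 *ᵥ ψ)).re + (μ₀ - μ) * (star ψ ⬝ᵥ (totalNumber *ᵥ ψ)).re :=
          add_le_add h0lo (mul_le_mul_of_nonpos_left hhi hd)
  · rw [re_star_dotProduct_dWaveSourceOpenBox_mulVec_eq a b U μ₀ μ 0 ψ]
    calc (star ψ ⬝ᵥ (dWaveSourceOpenBox a b U μ₀ 0 *ᵥ ψ)).re + (μ₀ - μ) * (star ψ ⬝ᵥ (totalNumber *ᵥ ψ)).re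
        ≤ (e0hi : ℝ) * ((a : ℝ) * b) + (μ₀ - μ) * ((nlo : ℝ) * ((a : ℝ) * b)) :=
          add_le_add h0hi (mul_le_mul_of_nonpos_left hlo hd)
      _ = ((e0hi : ℝ) + (μ₀ - μ) * nlo) * ((a : ℝ) * b) := by ring
      _ ≤ (e0hi' : ℝ) * ((a : ℝ) * b) := mul_le_mul_of_nonneg_right he0hi' hab

end Summit.Ventures.CertifiedManyBodySolver

end
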